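import Mathlib
import HarnessLib

/-!
# Venture HSemireg — the WEIGHT SELECTION RULE for the fibre-test supertrace

HONEST FRAMING. Lean leaf for the computation cell `pub-hsemireg` (target seat t-5 gen 23; file of record
`run/shared/lean/pub/pub-hsemireg/target-g6/KSX-EXACT-t5g23.md` §6). Setting of the cell's fibre test for
reduced-point complexes (TH3-SIGMA-ORBIT-PROOF §1): a pencil of three odd gluing operators `u₁ u₂ u₃`, closed classes
with components `B₁ B₂ B₃`, and the cubic form `T(B,B′,B″) = Σ_σ sgn σ · B_{σ1} B′_{σ2} B″_{σ3}` whose supertrace is the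
subject of the conjecture (W³)₄. If the pencil has an infinitesimal symmetry `(D, A)` — `D` block-diagonal with
`[D, u(s)] = u(As)` — then the closed-class space is stable under the induced action and, for a DIAGONAL frame part
`A = diag(a₁,a₂,a₃)`, a weight class of weight `w` satisfies `[D, Bᵢ] = (w + tr A − aᵢ) · Bᵢ` for each component. THIS FILE
kernel-checks the purely algebraic heart of the rule, in an arbitrary (associative, unital) algebra `R` over a commutative
ring `k`: (1) `ad D` is a derivation, so eigen-relations `[D,X] = a•X`, `[D,Y] = b•Y`, `[D,Z] = c•Z` give
`[D, XYZ] = (a+b+c)•XYZ`; (2) for three «classes» with component weights `w + t − aᵢ`, `w′ + t − aᵢ`, `w″ + t − aᵢ`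
(`t = a₁+a₂+a₃`) EVERY one of the six products in `T` has weight `w + w′ + w″ + 2t`, hence `[D, T] = (w+w′+w″+2t)•T`;
(3) if a `k`-linear functional `τ` kills all commutators `[D, M]` (every level trace and the supertrace do, `D` being
block-diagonal) and the total weight is not a zero divisor on the value (over a field: is non-zero), then `τ(T) = 0`.
Consequence recorded in the file of record (NOT formalised here: it needs the matrix model): on a configuration with a torus
symmetry, `str T(B,B′,B″) = 0` for weight classes unless `w + w′ + w″ = −2 tr A` («zero-weight triple»); on all 30 exact
simple non-flat four-level beds of the cell there is no zero-weight triple, while the amplitude-5 counter-instance has 7.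
Nothing here proves (W³)₄; no object on an abelian variety is constructed; nothing here bears on HC, HC_CM or HC_AV.
-/

namespace Summit.Ventures.HSemireg.WeightSelectionRule

variable {k R : Type*} [CommRing k] [Ring R] [Algebra k R]

/-- **`ad D` is a derivation (two factors):** `[D,X] = a•X` and `[D,Y] = b•Y` give `[D, XY] = (a+b)•XY`. [folklore] -/
theorem comm_mul_two_of_weights (D X Y : R) (a b : k)
    (hX : D * X - X * D = a • X) (hY : D * Y - Y * D = b • Y) :
    D * (X * Y) - (X * Y) * D = (a + b) • (X * Y) := by
  have key : D * (X * Y) - (X * Y) * D = (D * X - X * D) * Y + X * (D * Y - Y * D) := by noncomm_ring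
  rw [key, hX, hY, smul_mul_assoc, mul_smul_comm, add_smul]

/-- **`ad D` is a derivation (three factors):** `[D,X] = a•X`, `[D,Y] = b•Y`, `[D,Z] = c•Z` give
`[D, XYZ] = (a+b+c)•XYZ`. [folklore] -/
theorem comm_mul_three_of_weights (D X Y Z : R) (a b c : k)
    (hX : D * X - X * D = a • X) (hY : D * Y - Y * D = b • Y) (hZ : D * Z - Z * D = c • Z) :
    D * (X * Y * Z) - (X * Y * Z) * D = (a + b + c) • (X * Y * Z) := by
  have key : D * (X * Y * Z) - (X * Y * Z) * D
      = (D * X - X * D) * Y * Z + X * (D * Y - Y * D) * Z + X * Y * (D * Z - Z * D) := by noncomm_ring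
  rw [key, hX, hY, hZ]
  simp only [smul_mul_assoc, mul_smul_comm, add_smul]

/-- **A functional that kills `ad D`-commutators kills every `ad D`-eigenvector of regular weight.** If `τ` is `k`-linear
with `τ(DM − MD) = 0` for all `M`, and `[D, X] = a•X` with `a` regular for the scalar action on `k` (`IsSMulRegular k a`;
over a field: `a ≠ 0`, next lemma), then `τ X = 0`. [folklore] -/
theorem functional_eq_zero_of_weight (D X : R) (τ : R →ₗ[k] k) (hτ : ∀ M : R, τ (D * M - M * D) = 0)
    (a : k) (hX : D * X - X * D = a • X) (ha : IsSMulRegular k a) : τ X = 0 := by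
  have h1 : τ (D * X - X * D) = 0 := hτ X
  rw [hX, map_smul] at h1
  exact ha (by simpa using h1)

/-- Field version of `functional_eq_zero_of_weight`: `a ≠ 0 → τ X = 0`. [folklore] -/
theorem functional_eq_zero_of_weight_ne_zero {K S : Type*} [Field K] [Ring S] [Algebra K S]
    (D X : S) (τ : S →ₗ[K] K) (hτ : ∀ M : S, τ (D * M - M * D) = 0)
    (a : K) (hX : D * X - X * D = a • X) (ha : a ≠ 0) : τ X = 0 := by
  have h1 : τ (D * X - X * D) = 0 := hτ X
  rw [hX, map_smul, smul_eq_mul] at h1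
  rcases mul_eq_zero.mp h1 with h | h
  · exact absurd h ha
  · exact h

/-- **Weight of the cubic form.** If the components of three classes are `ad D`-eigenvectors with weights
`w + t - aᵢ`, `w′ + t - aᵢ`, `w″ + t - aᵢ` (`i = 1,2,3`; in the model `t = tr A = a₁+a₂+a₃` and `w, w′, w″` are the
class weights), and `t = a₁ + a₂ + a₃`, then `[D, T] = (w + w′ + w″ + 2t) • T` for the cell's cubic form
`T(B,C,E) = Σ_σ sgn σ · B_{σ1} C_{σ2} E_{σ3} = B₁C₂E₃ + B₂C₃E₁ + B₃C₁E₂ − B₁C₃E₂ − B₃C₂E₁ − B₂C₁E₃` (written out; each of the six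
products uses every component index exactly once). (KSX-EXACT-t5g23 §6.1 (ii).) -/
theorem comm_T6_weight (D B1 B2 B3 C1 C2 C3 E1 E2 E3 : R) (w w' w'' t a1 a2 a3 : k)
    (ht : t = a1 + a2 + a3)
    (hB1 : D * B1 - B1 * D = (w + t - a1) • B1) (hB2 : D * B2 - B2 * D = (w + t - a2) • B2)
    (hB3 : D * B3 - B3 * D = (w + t - a3) • B3)
    (hC1 : D * C1 - C1 * D = (w' + t - a1) • C1) (hC2 : D * C2 - C2 * D = (w' + t - a2) • C2)
    (hC3 : D * C3 - C3 * D = (w' + t - a3) • C3)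
    (hE1 : D * E1 - E1 * D = (w'' + t - a1) • E1) (hE2 : D * E2 - E2 * D = (w'' + t - a2) • E2)
    (hE3 : D * E3 - E3 * D = (w'' + t - a3) • E3) :
    D * (B1 * C2 * E3 + B2 * C3 * E1 + B3 * C1 * E2 - B1 * C3 * E2 - B3 * C2 * E1 - B2 * C1 * E3)
      - (B1 * C2 * E3 + B2 * C3 * E1 + B3 * C1 * E2 - B1 * C3 * E2 - B3 * C2 * E1 - B2 * C1 * E3) * D
      = (w + w' + w'' + 2 * t) • (B1 * C2 * E3 + B2 * C3 * E1 + B3 * C1 * E2 - B1 * C3 * E2 - B3 * C2 * E1 - B2 * C1 * E3) := by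
  have p123 := comm_mul_three_of_weights D B1 C2 E3 _ _ _ hB1 hC2 hE3
  have p231 := comm_mul_three_of_weights D B2 C3 E1 _ _ _ hB2 hC3 hE1
  have p312 := comm_mul_three_of_weights D B3 C1 E2 _ _ _ hB3 hC1 hE2
  have p132 := comm_mul_three_of_weights D B1 C3 E2 _ _ _ hB1 hC3 hE2
  have p321 := comm_mul_three_of_weights D B3 C2 E1 _ _ _ hB3 hC2 hE1
  have p213 := comm_mul_three_of_weights D B2 C1 E3 _ _ _ hB2 hC1 hE3
  -- all six total weights equal W := w + w' + w'' + 2t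
  have e1 : w + t - a1 + (w' + t - a2) + (w'' + t - a3) = w + w' + w'' + 2 * t := by rw [ht]; ring
  have e2 : w + t - a2 + (w' + t - a3) + (w'' + t - a1) = w + w' + w'' + 2 * t := by rw [ht]; ring
  have e3 : w + t - a3 + (w' + t - a1) + (w'' + t - a2) = w + w' + w'' + 2 * t := by rw [ht]; ring
  have e4 : w + t - a1 + (w' + t - a3) + (w'' + t - a2) = w + w' + w'' + 2 * t := by rw [ht]; ring
  have e5 : w + t - a3 + (w' + t - a2) + (w'' + t - a1) = w + w' + w'' + 2 * t := by rw [ht]; ring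
  have e6 : w + t - a2 + (w' + t - a1) + (w'' + t - a3) = w + w' + w'' + 2 * t := by rw [ht]; ring
  rw [e1] at p123; rw [e2] at p231; rw [e3] at p312; rw [e4] at p132; rw [e5] at p321; rw [e6] at p213
  have expand : D * (B1 * C2 * E3 + B2 * C3 * E1 + B3 * C1 * E2 - B1 * C3 * E2 - B3 * C2 * E1 - B2 * C1 * E3)
      - (B1 * C2 * E3 + B2 * C3 * E1 + B3 * C1 * E2 - B1 * C3 * E2 - B3 * C2 * E1 - B2 * C1 * E3) * D
      = (D * (B1 * C2 * E3) - B1 * C2 * E3 * D) + (D * (B2 * C3 * E1) - B2 * C3 * E1 * D)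
        + (D * (B3 * C1 * E2) - B3 * C1 * E2 * D) - (D * (B1 * C3 * E2) - B1 * C3 * E2 * D)
        - (D * (B3 * C2 * E1) - B3 * C2 * E1 * D) - (D * (B2 * C1 * E3) - B2 * C1 * E3 * D) := by
    noncomm_ring
  rw [expand, p123, p231, p312, p132, p321, p213]
  simp only [smul_add, smul_sub]

/-- **WEIGHT SELECTION RULE (field form; KSX-EXACT-t5g23 §6.1 (iii)).** Under the hypotheses of `comm_T6_weight`, any
`K`-linear functional `τ` vanishing on all commutators `[D, M]` (in the model: every level trace, hence the supertrace, for
block-diagonal `D`) vanishes on `T(B,B′,B″)` unless the total weight `w + w′ + w″ + 2t` is zero. -/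
theorem weight_selection_rule {K S : Type*} [Field K] [Ring S] [Algebra K S]
    (D B1 B2 B3 C1 C2 C3 E1 E2 E3 : S) (τ : S →ₗ[K] K) (hτ : ∀ M : S, τ (D * M - M * D) = 0)
    (w w' w'' t a1 a2 a3 : K) (ht : t = a1 + a2 + a3)
    (hB1 : D * B1 - B1 * D = (w + t - a1) • B1) (hB2 : D * B2 - B2 * D = (w + t - a2) • B2)
    (hB3 : D * B3 - B3 * D = (w + t - a3) • B3)
    (hC1 : D * C1 - C1 * D = (w' + t - a1) • C1) (hC2 : D * C2 - C2 * D = (w' + t - a2) • C2)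
    (hC3 : D * C3 - C3 * D = (w' + t - a3) • C3)
    (hE1 : D * E1 - E1 * D = (w'' + t - a1) • E1) (hE2 : D * E2 - E2 * D = (w'' + t - a2) • E2)
    (hE3 : D * E3 - E3 * D = (w'' + t - a3) • E3)
    (hW : w + w' + w'' + 2 * t ≠ 0) :
    τ (B1 * C2 * E3 + B2 * C3 * E1 + B3 * C1 * E2 - B1 * C3 * E2 - B3 * C2 * E1 - B2 * C1 * E3) = 0 :=
  functional_eq_zero_of_weight_ne_zero D _ τ hτ _
    (comm_T6_weight D B1 B2 B3 C1 C2 C3 E1 E2 E3 w w' w'' t a1 a2 a3 ht hB1 hB2 hB3 hC1 hC2 hC3 hE1 hE2 hE3) hW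

end Summit.Ventures.HSemireg.WeightSelectionRule
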